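import Summits.CriticalPhenomena.PercolationContinuityZ3.Theorems.PercNearOneGluingNoHeavyLowerTailCovTauAssembly
import Summits.CriticalPhenomena.PercolationContinuityZ3.Theorems.PercNearOneGluingNoHeavyLowerTailCovTauTransfer
import Summits.CriticalPhenomena.PercolationContinuityZ3.Theorems.PercNearOneGluingNoHeavyLowerTailSurplusTransferPairOfCov
import HarnessLib

/-!
# `NoHeavyLowerTail` (stmt-CriticalPhenomena-4575) — (S5)₂, (GEN) for three relays and Kozma–Nitzan's Conjecture 1 for
# `|A| = 3` FROM THE A2-DIAGONAL HYPOTHESIS (the COV(τ) chain assembled end to end)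

Support file (`--supports stmt-CriticalPhenomena-4575`), prover `prim-gen-induct` (gen 10).  No definitions, no named
facts, no sorries; standard axioms.

The cell's proof of the conditioned covariance transfer COV(τ) (seat memo prim-hp-8/COV-TAU-PROOF.md; three referee reports,
no gap; exact censuses 0 violations) has ONE open Lean piece: the diagonal two-source inequality A2 at `N = N' = {y}` (hp-8's
`E({y})·Y({y}) ≤ M({y})·X({y})`; its proof = decision-tree Harris (★_N) + vdBHK 1.4 + a vdBHK-1.1-type induction on `|V|` with
Ahlswede–Daykin), being formalised by prim-hp-4 (A2) and prim-ineq-prove-1 / prim-ineq-gen-6 ((★_N), exploration of a vertex set).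
Everything downstream is now in the tree, and this file composes it:

  A2-diagonal (hypothesis `H`, verbatim the binder of `CovTau.covTau_of_diagonal`, at `(x, y, o, v) = (b, a, o, v)`)
  ⟹ COV(τ) for every monotone edge-cluster functional (`CovTau.covTau_of_diagonal`, …CovTauAssembly)
  ⟹ COV(τ) for `F(C(b)) − F(C(a))` (`CovTau.covTransfer_of_covTau`, …CovTauTransfer)
  ⟹ (S5)₂ (`SurplusTransfer.surplusTransfer_pair_of_covTransfer`, prim-hp-8 / prim-hp-4)
  ⟹ (GEN) for three relays (`SurplusTransfer.gen_triple_of_covTransfer`)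
  ⟹ Kozma–Nitzan's Conjecture 1 for three relays (`F = 1{b' ∈ ·}`).

* `CovTau.covTransfer_of_diagonal`, `CovTau.surplusTransfer_pair_of_diagonal`, `CovTau.gen_triple_of_diagonal`,
  `CovTau.kn_conj1_three_of_diagonal`.
[cite: VandenbergHaggstromKahn2005, Thms. 1.3–1.5 (pp. 6–8), §2.1 (pp. 9–13)] [cite: KozmaNitzan2024, Conj. 1 (p. 3), Conj. 4 (p. 32)]
[cite: Gladkov2024, Thm. 3.2]
-/

noncomputable section

namespace Summit.CriticalPhenomena.PercolationContinuityZ3.Theorems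

open MeasureTheory Set Literature.Probability.LatticeModels Literature.Probability.Percolation
open scoped Classical
open KNPreFKG BHK2006

namespace CovTau

variable {V : Type*} [Fintype V]

/-- **The socket hypothesis `hCOV` of `SurplusTransfer.surplusTransfer_pair_of_covTransfer` from the A2-diagonal hypothesis**
(at `(x, y, o, v) = (b, a, o, v)`): `Cov(F(C_b) − F(C_a), 1{o∈C_b} | a↮b) ≥ μ(o↔v | v↮a, v↮b)·Cov(F(C_b) − F(C_a), 1{v∈C_b} | a↮b)`
in denominator-free form, for every `F` monotone on vertex sets and `v ≠ b`.
[cite: VandenbergHaggstromKahn2005, Thms. 1.3–1.4 (pp. 6–7), §2.1 (pp. 9–13)] [cite: KozmaNitzan2024, Conj. 4 (p. 32)] -/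
theorem covTransfer_of_diagonal (w : Sym2 V → unitInterval) (o v a b : V) (hvb : v ≠ b)
    (H : ∀ p : Sym2 V → unitInterval, (∀ e, 0 < p e ∧ p e < 1) →
      ∀ g : Set (Sym2 V) → ℝ, Monotone g → (∀ C, 0 ≤ g C) →
      (prodBernoulli p).real ({ω : BondConfig V | ¬ (openGraph ω).Reachable v b} ∩
          {ω | ¬ (openGraph ω).Reachable v a} ∩ openConn v o) *
        (∫ ω in {ω : BondConfig V | ¬ (openGraph ω).Reachable b a},
          ((∫ η in (openConn b v : Set (BondConfig V)), g (openEdgeCluster η b)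
              ∂(prodBernoulli fun e => if (∃ u ∈ e, (openGraph ω).Reachable a u)
                then (0 : unitInterval) else p e)) -
            (∫ η, g (openEdgeCluster η b)
              ∂(prodBernoulli fun e => if (∃ u ∈ e, (openGraph ω).Reachable a u)
                then (0 : unitInterval) else p e)) *
            (prodBernoulli fun e => if (∃ u ∈ e, (openGraph ω).Reachable a u)
                then (0 : unitInterval) else p e).real (openConn b v : Set (BondConfig V)))
          ∂(prodBernoulli p)) ≤
      (prodBernoulli p).real ({ω : BondConfig V | ¬ (openGraph ω).Reachable v b} ∩
          {ω | ¬ (openGraph ω).Reachable v a}) *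
        (∫ ω in {ω : BondConfig V | ¬ (openGraph ω).Reachable b a},
          ((prodBernoulli fun e => if (∃ u ∈ e, (openGraph ω).Reachable a u)
                then (0 : unitInterval) else p e).real
              ({η : BondConfig V | ¬ (openGraph η).Reachable v b} ∩ openConn v o) /
            (prodBernoulli fun e => if (∃ u ∈ e, (openGraph ω).Reachable a u)
                then (0 : unitInterval) else p e).real
              {η : BondConfig V | ¬ (openGraph η).Reachable v b}) *
          ((∫ η in (openConn b v : Set (BondConfig V)), g (openEdgeCluster η b)
              ∂(prodBernoulli fun e => if (∃ u ∈ e, (openGraph ω).Reachable a u)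
                then (0 : unitInterval) else p e)) -
            (∫ η, g (openEdgeCluster η b)
              ∂(prodBernoulli fun e => if (∃ u ∈ e, (openGraph ω).Reachable a u)
                then (0 : unitInterval) else p e)) *
            (prodBernoulli fun e => if (∃ u ∈ e, (openGraph ω).Reachable a u)
                then (0 : unitInterval) else p e).real (openConn b v : Set (BondConfig V)))
          ∂(prodBernoulli p)))
    (F : Set V → ℝ) (hF : ∀ S T : Set V, S ⊆ T → F S ≤ F T) :
    (prodBernoulli w).real (({ω : BondConfig V | ¬ (openGraph ω).Reachable v a} ∩ {ω | ¬ (openGraph ω).Reachable v b}) ∩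
              openConn o v) *
        ((prodBernoulli w).real ((openConn a b)ᶜ : Set (BondConfig V)) *
            ∫ ω in (openConn v b ∩ (openConn a b)ᶜ : Set (BondConfig V)), (F (openCluster ω b) - F (openCluster ω a)) ∂(prodBernoulli w) -
          (prodBernoulli w).real (openConn v b ∩ (openConn a b)ᶜ : Set (BondConfig V)) *
            ∫ ω in ((openConn a b)ᶜ : Set (BondConfig V)), (F (openCluster ω b) - F (openCluster ω a)) ∂(prodBernoulli w)) ≤
      (prodBernoulli w).real ({ω : BondConfig V | ¬ (openGraph ω).Reachable v a} ∩ {ω | ¬ (openGraph ω).Reachable v b}) *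
        ((prodBernoulli w).real ((openConn a b)ᶜ : Set (BondConfig V)) *
            ∫ ω in (openConn o b ∩ (openConn a b)ᶜ : Set (BondConfig V)), (F (openCluster ω b) - F (openCluster ω a)) ∂(prodBernoulli w) -
          (prodBernoulli w).real (openConn o b ∩ (openConn a b)ᶜ : Set (BondConfig V)) *
            ∫ ω in ((openConn a b)ᶜ : Set (BondConfig V)), (F (openCluster ω b) - F (openCluster ω a)) ∂(prodBernoulli w)) :=
  covTransfer_of_covTau w o v a b F
    (covTau_of_diagonal w b a o v hvb H _ (monotone_projFun w a b F hF))

/-- **(S5)₂ from the A2-diagonal hypothesis** (at `(x, y, o, v) = (b, a, o, v)`): for `F` monotone nonnegative on vertex sets,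
relays `a, b` with `m_a ≤ m_b` and observers `o`, `v ≠ a, b`, the surplus transfer `μ(D ∩ {o↔v})·Sur_v ≤ μ(D)·Sur_o`
(`D = {v↮a} ∩ {v↮b}`, `Sur_x = ∫_{x↔a ∨ x↔b} F(C(x)) − (μ(x↔a)·m_a + μ(x↔b, x↮a)·m_b)`).
[cite: VandenbergHaggstromKahn2005, Thms. 1.3–1.5 (pp. 6–8)] [cite: KozmaNitzan2024, Conj. 4 (p. 32)] -/
theorem surplusTransfer_pair_of_diagonal (w : Sym2 V → unitInterval) (o v a b : V) (hva : v ≠ a) (hvb : v ≠ b)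
    (H : ∀ p : Sym2 V → unitInterval, (∀ e, 0 < p e ∧ p e < 1) →
      ∀ g : Set (Sym2 V) → ℝ, Monotone g → (∀ C, 0 ≤ g C) →
      (prodBernoulli p).real ({ω : BondConfig V | ¬ (openGraph ω).Reachable v b} ∩
          {ω | ¬ (openGraph ω).Reachable v a} ∩ openConn v o) *
        (∫ ω in {ω : BondConfig V | ¬ (openGraph ω).Reachable b a},
          ((∫ η in (openConn b v : Set (BondConfig V)), g (openEdgeCluster η b)
              ∂(prodBernoulli fun e => if (∃ u ∈ e, (openGraph ω).Reachable a u)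
                then (0 : unitInterval) else p e)) -
            (∫ η, g (openEdgeCluster η b)
              ∂(prodBernoulli fun e => if (∃ u ∈ e, (openGraph ω).Reachable a u)
                then (0 : unitInterval) else p e)) *
            (prodBernoulli fun e => if (∃ u ∈ e, (openGraph ω).Reachable a u)
                then (0 : unitInterval) else p e).real (openConn b v : Set (BondConfig V)))
          ∂(prodBernoulli p)) ≤
      (prodBernoulli p).real ({ω : BondConfig V | ¬ (openGraph ω).Reachable v b} ∩
          {ω | ¬ (openGraph ω).Reachable v a}) *
        (∫ ω in {ω : BondConfig V | ¬ (openGraph ω).Reachable b a},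
          ((prodBernoulli fun e => if (∃ u ∈ e, (openGraph ω).Reachable a u)
                then (0 : unitInterval) else p e).real
              ({η : BondConfig V | ¬ (openGraph η).Reachable v b} ∩ openConn v o) /
            (prodBernoulli fun e => if (∃ u ∈ e, (openGraph ω).Reachable a u)
                then (0 : unitInterval) else p e).real
              {η : BondConfig V | ¬ (openGraph η).Reachable v b}) *
          ((∫ η in (openConn b v : Set (BondConfig V)), g (openEdgeCluster η b)
              ∂(prodBernoulli fun e => if (∃ u ∈ e, (openGraph ω).Reachable a u)
                then (0 : unitInterval) else p e)) -
            (∫ η, g (openEdgeCluster η b)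
              ∂(prodBernoulli fun e => if (∃ u ∈ e, (openGraph ω).Reachable a u)
                then (0 : unitInterval) else p e)) *
            (prodBernoulli fun e => if (∃ u ∈ e, (openGraph ω).Reachable a u)
                then (0 : unitInterval) else p e).real (openConn b v : Set (BondConfig V)))
          ∂(prodBernoulli p)))
    (F : Set V → ℝ) (hF : ∀ S T : Set V, S ⊆ T → F S ≤ F T) (hF0 : ∀ S, 0 ≤ F S)
    (hmab : ∫ ω, F (openCluster ω a) ∂(prodBernoulli w) ≤ ∫ ω, F (openCluster ω b) ∂(prodBernoulli w)) :
    (prodBernoulli w).real ({ω : BondConfig V | ¬ (openGraph ω).Reachable v a} ∩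
          {ω : BondConfig V | ¬ (openGraph ω).Reachable v b} ∩ openConn o v) *
        (∫ ω in (openConn v a ∪ openConn v b), F (openCluster ω v) ∂(prodBernoulli w) -
          ((prodBernoulli w).real (openConn v a) * ∫ ω, F (openCluster ω a) ∂(prodBernoulli w) +
            (prodBernoulli w).real (openConn v b ∩ (openConn v a)ᶜ : Set (BondConfig V)) *
              ∫ ω, F (openCluster ω b) ∂(prodBernoulli w))) ≤
      (prodBernoulli w).real ({ω : BondConfig V | ¬ (openGraph ω).Reachable v a} ∩
          {ω : BondConfig V | ¬ (openGraph ω).Reachable v b}) *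
        (∫ ω in (openConn o a ∪ openConn o b), F (openCluster ω o) ∂(prodBernoulli w) -
          ((prodBernoulli w).real (openConn o a) * ∫ ω, F (openCluster ω a) ∂(prodBernoulli w) +
            (prodBernoulli w).real (openConn o b ∩ (openConn o a)ᶜ : Set (BondConfig V)) *
              ∫ ω, F (openCluster ω b) ∂(prodBernoulli w))) :=
  SurplusTransfer.surplusTransfer_pair_of_covTransfer w o v a b hva hvb F hF hF0 hmab
    (covTransfer_of_diagonal w o v a b hvb H F hF)

/-- **(GEN) for three relays from the A2-diagonal hypothesis** (at `(x, y, o, v) = (a₂, a₁, o, a₃)`): for `F` monotone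
nonnegative, an observer `o`, relays with `m₁ ≤ m₂ ≤ m₃`, `a₃ ≠ a₁, a₂`:
`μ(o↔a₁)·m₁ + μ(o↔a₂, o↮a₁)·m₂ + μ(o↔a₃, o↮a₁, o↮a₂)·m₃ ≤ ∫_{o ↔ {a₁,a₂,a₃}} F(C(o))`.
[cite: KozmaNitzan2024, Conj. 4 (p. 32)] [cite: VandenbergHaggstromKahn2005, Thms. 1.3–1.5 (pp. 6–8)] -/
theorem gen_triple_of_diagonal (w : Sym2 V → unitInterval) (o a₁ a₂ a₃ : V) (h31 : a₃ ≠ a₁) (h32 : a₃ ≠ a₂)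
    (H : ∀ p : Sym2 V → unitInterval, (∀ e, 0 < p e ∧ p e < 1) →
      ∀ g : Set (Sym2 V) → ℝ, Monotone g → (∀ C, 0 ≤ g C) →
      (prodBernoulli p).real ({ω : BondConfig V | ¬ (openGraph ω).Reachable a₃ a₂} ∩
          {ω | ¬ (openGraph ω).Reachable a₃ a₁} ∩ openConn a₃ o) *
        (∫ ω in {ω : BondConfig V | ¬ (openGraph ω).Reachable a₂ a₁},
          ((∫ η in (openConn a₂ a₃ : Set (BondConfig V)), g (openEdgeCluster η a₂)
              ∂(prodBernoulli fun e => if (∃ u ∈ e, (openGraph ω).Reachable a₁ u)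
                then (0 : unitInterval) else p e)) -
            (∫ η, g (openEdgeCluster η a₂)
              ∂(prodBernoulli fun e => if (∃ u ∈ e, (openGraph ω).Reachable a₁ u)
                then (0 : unitInterval) else p e)) *
            (prodBernoulli fun e => if (∃ u ∈ e, (openGraph ω).Reachable a₁ u)
                then (0 : unitInterval) else p e).real (openConn a₂ a₃ : Set (BondConfig V)))
          ∂(prodBernoulli p)) ≤
      (prodBernoulli p).real ({ω : BondConfig V | ¬ (openGraph ω).Reachable a₃ a₂} ∩
          {ω | ¬ (openGraph ω).Reachable a₃ a₁}) *
        (∫ ω in {ω : BondConfig V | ¬ (openGraph ω).Reachable a₂ a₁},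
          ((prodBernoulli fun e => if (∃ u ∈ e, (openGraph ω).Reachable a₁ u)
                then (0 : unitInterval) else p e).real
              ({η : BondConfig V | ¬ (openGraph η).Reachable a₃ a₂} ∩ openConn a₃ o) /
            (prodBernoulli fun e => if (∃ u ∈ e, (openGraph ω).Reachable a₁ u)
                then (0 : unitInterval) else p e).real
              {η : BondConfig V | ¬ (openGraph η).Reachable a₃ a₂}) *
          ((∫ η in (openConn a₂ a₃ : Set (BondConfig V)), g (openEdgeCluster η a₂)
              ∂(prodBernoulli fun e => if (∃ u ∈ e, (openGraph ω).Reachable a₁ u)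
                then (0 : unitInterval) else p e)) -
            (∫ η, g (openEdgeCluster η a₂)
              ∂(prodBernoulli fun e => if (∃ u ∈ e, (openGraph ω).Reachable a₁ u)
                then (0 : unitInterval) else p e)) *
            (prodBernoulli fun e => if (∃ u ∈ e, (openGraph ω).Reachable a₁ u)
                then (0 : unitInterval) else p e).real (openConn a₂ a₃ : Set (BondConfig V)))
          ∂(prodBernoulli p)))
    (F : Set V → ℝ) (hF : ∀ S T : Set V, S ⊆ T → F S ≤ F T) (hF0 : ∀ S, 0 ≤ F S)
    (hm12 : ∫ ω, F (openCluster ω a₁) ∂(prodBernoulli w) ≤ ∫ ω, F (openCluster ω a₂) ∂(prodBernoulli w))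
    (hm23 : ∫ ω, F (openCluster ω a₂) ∂(prodBernoulli w) ≤ ∫ ω, F (openCluster ω a₃) ∂(prodBernoulli w)) :
    (prodBernoulli w).real (openConn o a₁) * ∫ ω, F (openCluster ω a₁) ∂(prodBernoulli w) +
        (prodBernoulli w).real (openConn o a₂ ∩ (openConn o a₁)ᶜ : Set (BondConfig V)) *
          ∫ ω, F (openCluster ω a₂) ∂(prodBernoulli w) +
        (prodBernoulli w).real (openConn o a₃ ∩ (openConn o a₁ ∪ openConn o a₂)ᶜ : Set (BondConfig V)) *
          ∫ ω, F (openCluster ω a₃) ∂(prodBernoulli w) ≤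
      ∫ ω in (openConn o a₁ ∪ openConn o a₂ ∪ openConn o a₃), F (openCluster ω o) ∂(prodBernoulli w) :=
  SurplusTransfer.gen_triple_of_covTransfer w o a₁ a₂ a₃ h31 h32 F hF hF0 hm12 hm23
    (covTransfer_of_diagonal w o a₃ a₁ a₂ h32 H F hF)

/-- **Kozma–Nitzan's Conjecture 1 for three relays from the A2-diagonal hypothesis** (at `(x, y, o, v) = (a₂, a₁, o, a₃)`, relays
ordered `μ(a₁↔b') ≤ μ(a₂↔b') ≤ μ(a₃↔b')`, `a₃ ≠ a₁, a₂`): if `t ≤ μ(a_i ↔ b')` for all `i` then `t·μ(o ↔ {a₁,a₂,a₃}) ≤ μ(o ↔ b')`.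
Proof: `gen_triple_of_diagonal` at `F = 1{b' ∈ ·}` (prim-hp-4's bookkeeping). [cite: KozmaNitzan2024, Conj. 1 (p. 3)] -/
theorem kn_conj1_three_of_diagonal (w : Sym2 V → unitInterval) (o b' a₁ a₂ a₃ : V) (h31 : a₃ ≠ a₁) (h32 : a₃ ≠ a₂)
    (H : ∀ p : Sym2 V → unitInterval, (∀ e, 0 < p e ∧ p e < 1) →
      ∀ g : Set (Sym2 V) → ℝ, Monotone g → (∀ C, 0 ≤ g C) →
      (prodBernoulli p).real ({ω : BondConfig V | ¬ (openGraph ω).Reachable a₃ a₂} ∩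
          {ω | ¬ (openGraph ω).Reachable a₃ a₁} ∩ openConn a₃ o) *
        (∫ ω in {ω : BondConfig V | ¬ (openGraph ω).Reachable a₂ a₁},
          ((∫ η in (openConn a₂ a₃ : Set (BondConfig V)), g (openEdgeCluster η a₂)
              ∂(prodBernoulli fun e => if (∃ u ∈ e, (openGraph ω).Reachable a₁ u)
                then (0 : unitInterval) else p e)) -
            (∫ η, g (openEdgeCluster η a₂)
              ∂(prodBernoulli fun e => if (∃ u ∈ e, (openGraph ω).Reachable a₁ u)
                then (0 : unitInterval) else p e)) *
            (prodBernoulli fun e => if (∃ u ∈ e, (openGraph ω).Reachable a₁ u)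
                then (0 : unitInterval) else p e).real (openConn a₂ a₃ : Set (BondConfig V)))
          ∂(prodBernoulli p)) ≤
      (prodBernoulli p).real ({ω : BondConfig V | ¬ (openGraph ω).Reachable a₃ a₂} ∩
          {ω | ¬ (openGraph ω).Reachable a₃ a₁}) *
        (∫ ω in {ω : BondConfig V | ¬ (openGraph ω).Reachable a₂ a₁},
          ((prodBernoulli fun e => if (∃ u ∈ e, (openGraph ω).Reachable a₁ u)
                then (0 : unitInterval) else p e).real
              ({η : BondConfig V | ¬ (openGraph η).Reachable a₃ a₂} ∩ openConn a₃ o) /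
            (prodBernoulli fun e => if (∃ u ∈ e, (openGraph ω).Reachable a₁ u)
                then (0 : unitInterval) else p e).real
              {η : BondConfig V | ¬ (openGraph η).Reachable a₃ a₂}) *
          ((∫ η in (openConn a₂ a₃ : Set (BondConfig V)), g (openEdgeCluster η a₂)
              ∂(prodBernoulli fun e => if (∃ u ∈ e, (openGraph ω).Reachable a₁ u)
                then (0 : unitInterval) else p e)) -
            (∫ η, g (openEdgeCluster η a₂)
              ∂(prodBernoulli fun e => if (∃ u ∈ e, (openGraph ω).Reachable a₁ u)
                then (0 : unitInterval) else p e)) *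
            (prodBernoulli fun e => if (∃ u ∈ e, (openGraph ω).Reachable a₁ u)
                then (0 : unitInterval) else p e).real (openConn a₂ a₃ : Set (BondConfig V)))
          ∂(prodBernoulli p)))
    (hm12 : (prodBernoulli w).real (openConn a₁ b') ≤ (prodBernoulli w).real (openConn a₂ b'))
    (hm23 : (prodBernoulli w).real (openConn a₂ b') ≤ (prodBernoulli w).real (openConn a₃ b'))
    (t : ℝ) (ht1 : t ≤ (prodBernoulli w).real (openConn a₁ b')) :
    t * (prodBernoulli w).real (openConn o a₁ ∪ openConn o a₂ ∪ openConn o a₃ : Set (BondConfig V)) ≤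
      (prodBernoulli w).real (openConn o b') := by
  classical
  set μ := prodBernoulli w with hμ
  have hmeas : ∀ S : Set (BondConfig V), MeasurableSet S := fun _ => MeasurableSet.of_discrete
  have hn := fun (S : Set (BondConfig V)) => (measureReal_nonneg : 0 ≤ μ.real S)
  -- the set function `F = 1{b' ∈ ·}` (prim-hp-4's bookkeeping, `SurplusTransfer.kn_conj1_three_of_plusTransfer`)
  set F : Set V → ℝ := fun M => if b' ∈ M then 1 else 0 with hF
  have hFmono : ∀ S T : Set V, S ⊆ T → F S ≤ F T := by
    intro S T hST
    simp only [hF]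
    by_cases hS : b' ∈ S
    · rw [if_pos hS, if_pos (hST hS)]
    · rw [if_neg hS]
      split_ifs <;> norm_num
  have hF0 : ∀ S, 0 ≤ F S := by
    intro S
    simp only [hF]
    split_ifs <;> norm_num
  have hFind : ∀ x : V, (fun ω : BondConfig V => F (openCluster ω x)) = (openConn x b' : Set (BondConfig V)).indicator 1 := by
    intro x
    funext ω
    simp only [hF]
    by_cases hω : ω ∈ (openConn x b' : Set (BondConfig V))
    · rw [Set.indicator_of_mem hω, Pi.one_apply, if_pos (show b' ∈ openCluster ω x from hω)]
    · rw [Set.indicator_of_notMem hω, if_neg (show b' ∉ openCluster ω x from hω)]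
  have hint : ∀ x : V, ∫ ω, F (openCluster ω x) ∂μ = μ.real (openConn x b') := by
    intro x
    rw [hFind x, integral_indicator_one (hmeas _)]
  have hsetint : ∀ (x : V) (S : Set (BondConfig V)), ∫ ω in S, F (openCluster ω x) ∂μ = μ.real (S ∩ openConn x b' : Set (BondConfig V)) := by
    intro x S
    rw [hFind x, ← integral_indicator (hmeas _), Set.indicator_indicator, integral_indicator_one ((hmeas _).inter (hmeas _))]
  have key := gen_triple_of_diagonal w o a₁ a₂ a₃ h31 h32 H F hFmono hF0
    (by rw [hint, hint]; exact hm12) (by rw [hint, hint]; exact hm23)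
  rw [hint, hint, hint, hsetint] at key
  -- `Σ μ(P_i) = μ(U)` and `t ≤ m_i`
  set U : Set (BondConfig V) := openConn o a₁ ∪ openConn o a₂ ∪ openConn o a₃ with hU
  have hP : μ.real U = μ.real (openConn o a₁) + μ.real (openConn o a₂ ∩ (openConn o a₁)ᶜ : Set (BondConfig V)) +
      μ.real (openConn o a₃ ∩ (openConn o a₁ ∪ openConn o a₂)ᶜ : Set (BondConfig V)) := by
    have h1 : μ.real U = μ.real (U ∩ (openConn o a₁ ∪ openConn o a₂)) + μ.real (U \ (openConn o a₁ ∪ openConn o a₂)) :=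
      (measureReal_inter_add_sdiff (s := U) (h := measure_ne_top _ _) ((hmeas _).union (hmeas _))).symm
    have h2 : μ.real (openConn o a₁ ∪ openConn o a₂ : Set (BondConfig V)) =
        μ.real ((openConn o a₁ ∪ openConn o a₂ : Set (BondConfig V)) ∩ openConn o a₁) +
          μ.real ((openConn o a₁ ∪ openConn o a₂ : Set (BondConfig V)) \ openConn o a₁) :=
      (measureReal_inter_add_sdiff (s := (openConn o a₁ ∪ openConn o a₂ : Set (BondConfig V))) (h := measure_ne_top _ _) (hmeas _)).symm
    rw [inter_eq_right.2 subset_union_left, hU, Set.union_sdiff_left, Set.sdiff_eq] at h1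
    rw [inter_eq_right.2 subset_union_left, Set.union_sdiff_left, Set.sdiff_eq] at h2
    rw [hU, h1, h2]
  have ht2 : t ≤ μ.real (openConn a₂ b') := ht1.trans hm12
  have ht3 : t ≤ μ.real (openConn a₃ b') := ht2.trans hm23
  have hmono : μ.real (U ∩ openConn o b' : Set (BondConfig V)) ≤ μ.real (openConn o b') :=
    measureReal_mono inter_subset_right (measure_ne_top _ _)
  rw [hP]
  nlinarith [key, hmono, hn (openConn o a₁), hn (openConn o a₂ ∩ (openConn o a₁)ᶜ),
    hn (openConn o a₃ ∩ (openConn o a₁ ∪ openConn o a₂)ᶜ),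
    mul_le_mul_of_nonneg_right ht1 (hn (openConn o a₁)),
    mul_le_mul_of_nonneg_right ht2 (hn (openConn o a₂ ∩ (openConn o a₁)ᶜ)),
    mul_le_mul_of_nonneg_right ht3 (hn (openConn o a₃ ∩ (openConn o a₁ ∪ openConn o a₂)ᶜ))]

end CovTau

end Summit.CriticalPhenomena.PercolationContinuityZ3.Theorems

end
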